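import Summits.BirchSwinnertonDyer.BirchSwinnertonDyer.Theorems.KimAtThreeFineKatoPrintPositionCrux
import Literature.NumberTheory.PAdicHodge.DualExpEllipticTowerSelf
import HarnessLib

/-!
# Crux `KatoKuriharaPortThreeShared` (stmt-BirchSwinnertonDyer-19560) BY NAME from FOUR cite facts ∧ hKatoPrintPos₀
# (cell `bsd-addord`, seat kim3 gen 17 = the crux's LEAD; `--supports 19560`, helper)

HONEST FRAMING.  One composition theorem (no definition, no named fact, no instance, no `sorry`): w2-acc4's
`KimAtThreeFineKatoPrintPositionCrux.katoKuriharaPortThreeShared_of_facts_of_katoPrintPos`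
(crux ⟸ {S5a, S5b, S5b-tower, P123, DR} [cite] ∧ hKatoPrintPos₀, p537199) with its (S5b) hypothesis DISCHARGED by the Literature
theorem `PAdicHodge.exists_smul_range_expStarCoord_iff_trace_log_of_tower` ((S5b-tower) ⇒ (S5b): the single-field Tate-duality
range fact is the trivial-tower case of the simultaneous Néron normalisation; kim3 g17, `PAdicHodge/DualExpEllipticTowerSelf`).
So, in the kernel: **crux ⟸ {S5a, S5b-tower, P123, DR} [FOUR cite facts] ∧ hKatoPrintPos₀** — the residual of record of the line
`perFactorKato` (skeleton v4).  hKatoPrintPos₀ is VERBATIM the hypothesis of p537199 (Kato 2004's printed clauses (C1) (C2) (C4)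
(C5) over the DEFINED `katoLambda` in one chart family, (RES₀), and the ONE non-print conjunct POS(dK, κK) — the LEAD memo
HOME/kim3/KIM3-POS-g16.md Theorem A / Cor. B proves POS on paper for Kato's own datum).  NOT a closing theorem (hKatoPrintPos₀
displayed; four cite facts as hypotheses); BSD / 19560 NOT proved by this file.

References: as in `KimAtThreeFineKatoPrintPositionCrux` [Kato2004Asterisque] [Kato1993LNM1553] [BlochKato1990]; [MilneFT2022] Ch. 7.
-/

noncomputable section
-- the cell's Theorems namespace `Summit.BirchSwinnertonDyer.BirchSwinnertonDyer.…` repeats the summit name by design (D-0017)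
set_option linter.dupNamespace false

open scoped Classical NumberField TensorProduct ContRepresentation Pointwise
open Field ValuativeRel Function IsDedekindDomain NumberField WeierstrassCurve Literature.NumberTheory.EllipticCurves
open Literature.NumberTheory.GaloisRepresentations Literature.NumberTheory.GaloisRepresentations.DiscreteGaloisModule
open Literature.NumberTheory.GaloisCohomology Literature.NumberTheory.GaloisRepresentations.PeriodRingData
open Literature.NumberTheory.PAdicHodge Literature.NumberTheory.EllipticCurves.ModularForms
open Literature.NumberTheory.EllipticCurves.Rank1Residual Literature.NumberTheory.EllipticCurves.Kato2004
open Literature.NumberTheory.EllipticCurves.Kato2004.EulerSystemValues Literature.NumberTheory.AdelicBaseChange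
open Literature.NumberTheory.Automorphic Summit.BirchSwinnertonDyer.Rank1Residual.GaloisImage
open Summit.BirchSwinnertonDyer.Rank1Residual.Additive.LocalLog Summit.BirchSwinnertonDyer.BirchSwinnertonDyer.Theorems
open KimAtThreeFineKatoPerFactorDefined KimAtThreeDeepLowerExpStarOmega KimAtThreeDeepLowerExpStarOmegaPlace
open KimAtThreeFineKatoPerFactorPlaces KimAtThreeDeepUpperExpStarFacts KimAtThreeDeepUpperExpStarFactsCanonical
open KimAtThreeFineKatoDefinedLambda KimAtThreeFineKatoDefinedLambdaPosition KimAtThreeFineKatoPrintPosition Rat.HeightOneSpectrum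


namespace Summit.BirchSwinnertonDyer.BirchSwinnertonDyer.Theorems.KimAtThreeFineKatoPrintPositionCruxFour

set_option backward.isDefEq.respectTransparency false in
set_option maxHeartbeats 800000 in
/-- **Crux `KatoKuriharaPortThreeShared` (stmt-BirchSwinnertonDyer-19560) BY NAME from FOUR cite facts — (S5a), (S5b-tower),
(P123), (DR) — and the print-shaped hKatoPrintPos₀**; the former fifth hypothesis (S5b) is the theorem
`exists_smul_range_expStarCoord_iff_trace_log_of_tower hTow`.  NOT a closing theorem (hKatoPrintPos₀ displayed; four cite facts
as hypotheses).
[cite: Kato2004Asterisque, (8.1.3) (p. 180), Prop. 8.12 (p. 186), §8.2 and Lemma 8.5 (pp. 180–184), §9.4 and Thm. 9.7 (pp. 188–189), Thm. 6.6 (1) (p. 163), Thm. 16.6.2, Ex. 13.3 (pp. 224–225)]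
[cite: BlochKato1990, §3 (Prop. 3.8, Ex. 3.11)] [cite: Kato1993LNM1553, Ch. II Prop. 1.2.3, §1.2.4 and Thm. 1.4.1] [cite: MilneFT2022, Ch. 7] -/
theorem katoKuriharaPortThreeShared_of_four_facts_of_katoPrintPos (hA : expStarCoord_eq_zero_iff_kummer)
    (hTow : exists_smul_range_expStarCoord_tower_iff_trace_log)
    (hP : cupLogInjective_and_hasDualExp_of_isDeRham)
    (hDR : isDeRham_restrictedRationalTateRep)
    (hKatoPrintPos₀ : ∀ (W : WeierstrassCurve ℚ) [W.IsElliptic] [W.IsGloballyMinimal]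
      [ContinuousSMul ℤ_[3] (W.tateModule 3)] [Module.Free ℤ_[3] (W.tateModule 3)]
      [Module.Finite ℤ_[3] (W.tateModule 3)],
      (∀ m : ℕ, W.HasSurjectiveModNGaloisRep (3 ^ m : ℕ)) →
      (haveI : Fact (Nat.Prime 3) := ⟨Nat.prime_three⟩; Addv W 3) →
      ¬ 3 ∣ (W.baseChange ℚ_[3]).localTamagawaNumber ℤ_[3] →
      Nat.card {Q : (W.baseChange ℚ_[3]).toAffine.Point // (3 : ℕ) • Q = 0} = 1 →
      ∀ {N : ℕ} [NeZero N] (P : ModularParametrizationData W N), N = W.conductorNorm ℤ →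
        (∀ z ∈ P.L.lattice, ∃ w ∈ periodLattice P.f, z = P.c * w) →
        ¬ (3 : ℤ) ∣ P.maninConstant →
        haveI : Fact (((3 : ℕ) : 𝓞 ℚ) ∈ ((Rat.HeightOneSpectrum.primesEquiv (R := 𝓞 ℚ)).symm ⟨3, Fact.out⟩).asIdeal) :=
          ⟨(natCast_mem_asIdeal_iff_eq_primesEquiv_symm _ Nat.prime_three).mpr rfl⟩
        letI := valuativeRelPlace ((Rat.HeightOneSpectrum.primesEquiv (R := 𝓞 ℚ)).symm ⟨3, Fact.out⟩)
        letI := topologicalSpacePlace ((Rat.HeightOneSpectrum.primesEquiv (R := 𝓞 ℚ)).symm ⟨3, Fact.out⟩)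
        haveI := isNonarchimedeanLocalField_place ((Rat.HeightOneSpectrum.primesEquiv (R := 𝓞 ℚ)).symm ⟨3, Fact.out⟩)
        haveI := charZero_place ((Rat.HeightOneSpectrum.primesEquiv (R := 𝓞 ℚ)).symm ⟨3, Fact.out⟩)
        letI := padicAlgebraPlace 3 ((Rat.HeightOneSpectrum.primesEquiv (R := 𝓞 ℚ)).symm ⟨3, Fact.out⟩)
        haveI := fact_not_isUnit_place 3 ((Rat.HeightOneSpectrum.primesEquiv (R := 𝓞 ℚ)).symm ⟨3, Fact.out⟩)
        haveI := isAdicComplete_place 3 ((Rat.HeightOneSpectrum.primesEquiv (R := 𝓞 ℚ)).symm ⟨3, Fact.out⟩)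
        ∃ (dK : LocalNeronLineAt W 3 ((Rat.HeightOneSpectrum.primesEquiv (R := 𝓞 ℚ)).symm ⟨3, Fact.out⟩))
          (ι : (n : ℕ) → (CyclotomicField n ℚ →+* ℂ)) (κK : ℝ)
          (w₀ : ∀ (k : ℕ) (r : Finset (HeightOneSpectrum (𝓞 ℚ))), (((Rat.HeightOneSpectrum.primesEquiv (R := 𝓞 ℚ)).symm ⟨3, Fact.out⟩).Extension (𝓞 (CyclotomicField (cycLevel 3 k r) ℚ))))
          (Ψ : ∀ (k : ℕ) (r : Finset (HeightOneSpectrum (𝓞 ℚ))), ℚ_[3] ⊗[ℚ] CyclotomicField (cycLevel 3 k r) ℚ ≃ₐ[ℚ]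
            (Π w : (((Rat.HeightOneSpectrum.primesEquiv (R := 𝓞 ℚ)).symm ⟨3, Fact.out⟩).Extension (𝓞 (CyclotomicField (cycLevel 3 k r) ℚ))), w.1.adicCompletion (CyclotomicField (cycLevel 3 k r) ℚ)))
          (hΨ : ∀ (k : ℕ) (r : Finset (HeightOneSpectrum (𝓞 ℚ))) (s : ℚ_[3]) (x : CyclotomicField (cycLevel 3 k r) ℚ) (w : (((Rat.HeightOneSpectrum.primesEquiv (R := 𝓞 ℚ)).symm ⟨3, Fact.out⟩).Extension (𝓞 (CyclotomicField (cycLevel 3 k r) ℚ)))),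
            Ψ k r (s ⊗ₜ[ℚ] x) w =
              algebraMap (CyclotomicField (cycLevel 3 k r) ℚ) (w.1.adicCompletion (CyclotomicField (cycLevel 3 k r) ℚ)) x *
              algebraMap (((Rat.HeightOneSpectrum.primesEquiv (R := 𝓞 ℚ)).symm ⟨3, Fact.out⟩).adicCompletion ℚ) (w.1.adicCompletion (CyclotomicField (cycLevel 3 k r) ℚ))
                ((Padic.adicCompletionEquiv (𝓞 ℚ) ⟨3, Fact.out⟩) s))
          (g : ∀ (k : ℕ) (r : Finset (HeightOneSpectrum (𝓞 ℚ))), (((Rat.HeightOneSpectrum.primesEquiv (R := 𝓞 ℚ)).symm ⟨3, Fact.out⟩).Extension (𝓞 (CyclotomicField (cycLevel 3 k r) ℚ))) → absoluteGaloisGroup ℚ)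
          (hg : ∀ (k : ℕ) (r : Finset (HeightOneSpectrum (𝓞 ℚ))) (w : (((Rat.HeightOneSpectrum.primesEquiv (R := 𝓞 ℚ)).symm ⟨3, Fact.out⟩).Extension (𝓞 (CyclotomicField (cycLevel 3 k r) ℚ)))),
            sigma (cycLevel 3 k r) (modNCyclotomicCharacter ℚ (cycLevel 3 k r) (g k r w)) • w.1 = (w₀ k r).1)
          (dw : ∀ (k : ℕ) (r : Finset (HeightOneSpectrum (𝓞 ℚ))),
            letI := LocalField.charZero_adicCompletion (w₀ k r).1
            letI := LocalField.adicCompletionPadicAlgebra (w₀ k r).1 3 (three_mem_asIdeal_extension _ (w₀ k r))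
            haveI : Fact (¬ IsUnit ((3 : ℕ) : integerC ((w₀ k r).1.adicCompletion (CyclotomicField (cycLevel 3 k r) ℚ)))) :=
              ⟨not_isUnit_natCast_integerC (LocalField.valuation_adicCompletion_natCast_lt_one (w₀ k r).1 3 (three_mem_asIdeal_extension _ (w₀ k r)))⟩
            haveI := isAdicComplete_integerC_natCast (LocalField.valuation_adicCompletion_natCast_lt_one (w₀ k r).1 3 (three_mem_asIdeal_extension _ (w₀ k r)))
            LocalNeronLine W (LocalField.valuation_adicCompletion_natCast_lt_one (w₀ k r).1 3 (three_mem_asIdeal_extension _ (w₀ k r))) ((galRestrictPlace ((Rat.HeightOneSpectrum.primesEquiv (R := 𝓞 ℚ)).symm ⟨3, Fact.out⟩)).comp (absGaloisRestrict (((Rat.HeightOneSpectrum.primesEquiv (R := 𝓞 ℚ)).symm ⟨3, Fact.out⟩).adicCompletion ℚ) ((w₀ k r).1.adicCompletion (CyclotomicField (cycLevel 3 k r) ℚ)))))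
          (hinjw : ∀ (k : ℕ) (r : Finset (HeightOneSpectrum (𝓞 ℚ))),
            letI := LocalField.charZero_adicCompletion (w₀ k r).1
            letI := LocalField.adicCompletionPadicAlgebra (w₀ k r).1 3 (three_mem_asIdeal_extension _ (w₀ k r))
            haveI : Fact (¬ IsUnit ((3 : ℕ) : integerC ((w₀ k r).1.adicCompletion (CyclotomicField (cycLevel 3 k r) ℚ)))) :=
              ⟨not_isUnit_natCast_integerC (LocalField.valuation_adicCompletion_natCast_lt_one (w₀ k r).1 3 (three_mem_asIdeal_extension _ (w₀ k r)))⟩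
            haveI := isAdicComplete_integerC_natCast (LocalField.valuation_adicCompletion_natCast_lt_one (w₀ k r).1 3 (three_mem_asIdeal_extension _ (w₀ k r)))
            (bdRPeriodRingData (LocalField.valuation_adicCompletion_natCast_lt_one (w₀ k r).1 3 (three_mem_asIdeal_extension _ (w₀ k r)))).CupLogInjective (logCyclotomic 3) (localRationalTateRep W 3 ((galRestrictPlace ((Rat.HeightOneSpectrum.primesEquiv (R := 𝓞 ℚ)).symm ⟨3, Fact.out⟩)).comp (absGaloisRestrict (((Rat.HeightOneSpectrum.primesEquiv (R := 𝓞 ℚ)).symm ⟨3, Fact.out⟩).adicCompletion ℚ) ((w₀ k r).1.adicCompletion (CyclotomicField (cycLevel 3 k r) ℚ))))))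
          (hexw : ∀ (k : ℕ) (r : Finset (HeightOneSpectrum (𝓞 ℚ))),
            letI := LocalField.charZero_adicCompletion (w₀ k r).1
            letI := LocalField.adicCompletionPadicAlgebra (w₀ k r).1 3 (three_mem_asIdeal_extension _ (w₀ k r))
            haveI : Fact (¬ IsUnit ((3 : ℕ) : integerC ((w₀ k r).1.adicCompletion (CyclotomicField (cycLevel 3 k r) ℚ)))) :=
              ⟨not_isUnit_natCast_integerC (LocalField.valuation_adicCompletion_natCast_lt_one (w₀ k r).1 3 (three_mem_asIdeal_extension _ (w₀ k r)))⟩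
            haveI := isAdicComplete_integerC_natCast (LocalField.valuation_adicCompletion_natCast_lt_one (w₀ k r).1 3 (three_mem_asIdeal_extension _ (w₀ k r)))
            ∀ z : contOneCocycles (localRationalTateRep W 3 ((galRestrictPlace ((Rat.HeightOneSpectrum.primesEquiv (R := 𝓞 ℚ)).symm ⟨3, Fact.out⟩)).comp (absGaloisRestrict (((Rat.HeightOneSpectrum.primesEquiv (R := 𝓞 ℚ)).symm ⟨3, Fact.out⟩).adicCompletion ℚ) ((w₀ k r).1.adicCompletion (CyclotomicField (cycLevel 3 k r) ℚ))))).toTopRep,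
              (bdRPeriodRingData (LocalField.valuation_adicCompletion_natCast_lt_one (w₀ k r).1 3 (three_mem_asIdeal_extension _ (w₀ k r)))).HasDualExp (logCyclotomic 3) (localRationalTateRep W 3 ((galRestrictPlace ((Rat.HeightOneSpectrum.primesEquiv (R := 𝓞 ℚ)).symm ⟨3, Fact.out⟩)).comp (absGaloisRestrict (((Rat.HeightOneSpectrum.primesEquiv (R := 𝓞 ℚ)).symm ⟨3, Fact.out⟩).adicCompletion ℚ) ((w₀ k r).1.adicCompletion (CyclotomicField (cycLevel 3 k r) ℚ))))) fun σ => z.1 σ),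
          κK ≠ 0 ∧
          (∃ u : ℚ, (u : ℝ) = κK ∧
            ∀ (hinj : (bdRPeriodRingData (valuation_place_lt_one 3 ((Rat.HeightOneSpectrum.primesEquiv (R := 𝓞 ℚ)).symm ⟨3, Fact.out⟩))).CupLogInjective (logCyclotomic 3)
              (localRationalTateRep W 3 (galRestrictPlace ((Rat.HeightOneSpectrum.primesEquiv (R := 𝓞 ℚ)).symm ⟨3, Fact.out⟩))))
            (hex : ∀ z : contOneCocycles (localRationalTateRep W 3 (galRestrictPlace ((Rat.HeightOneSpectrum.primesEquiv (R := 𝓞 ℚ)).symm ⟨3, Fact.out⟩))).toTopRep,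
              (bdRPeriodRingData (valuation_place_lt_one 3 ((Rat.HeightOneSpectrum.primesEquiv (R := 𝓞 ℚ)).symm ⟨3, Fact.out⟩))).HasDualExp (logCyclotomic 3)
                (localRationalTateRep W 3 (galRestrictPlace ((Rat.HeightOneSpectrum.primesEquiv (R := 𝓞 ℚ)).symm ⟨3, Fact.out⟩))) fun σ => z.1 σ)
              (e : ((Rat.HeightOneSpectrum.primesEquiv (R := 𝓞 ℚ)).symm ⟨3, Fact.out⟩).adicCompletion ℚ) (he : e ≠ 0),
              (∀ a : ℚ_[3], (∃ y, (expStarOmegaPadicAt (dK.smul e he) hinj hex (((Padic.adicCompletionEquiv (𝓞 ℚ) ⟨3, Fact.out⟩).symm : (((Rat.HeightOneSpectrum.primesEquiv (R := 𝓞 ℚ)).symm ⟨3, Fact.out⟩).adicCompletion ℚ) →+* ℚ_[3]))) y = a) ↔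
                ∀ Q : (W.baseChange ℚ_[3]).toAffine.Point, ‖a * padicLog (W.baseChange ℚ_[3]) Q‖ ≤ 1) →
              padicValRat 3 u = ((((Padic.adicCompletionEquiv (𝓞 ℚ) ⟨3, Fact.out⟩).symm : (((Rat.HeightOneSpectrum.primesEquiv (R := 𝓞 ℚ)).symm ⟨3, Fact.out⟩).adicCompletion ℚ) →+* ℚ_[3])) e).valuation) ∧
          (∀ (k : ℕ) (r : Finset (HeightOneSpectrum (𝓞 ℚ))),
            letI := LocalField.charZero_adicCompletion (w₀ k r).1
            letI := LocalField.adicCompletionPadicAlgebra (w₀ k r).1 3 (three_mem_asIdeal_extension _ (w₀ k r))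
            haveI : Fact (¬ IsUnit ((3 : ℕ) : integerC ((w₀ k r).1.adicCompletion (CyclotomicField (cycLevel 3 k r) ℚ)))) :=
              ⟨not_isUnit_natCast_integerC (LocalField.valuation_adicCompletion_natCast_lt_one (w₀ k r).1 3 (three_mem_asIdeal_extension _ (w₀ k r)))⟩
            haveI := isAdicComplete_integerC_natCast (LocalField.valuation_adicCompletion_natCast_lt_one (w₀ k r).1 3 (three_mem_asIdeal_extension _ (w₀ k r)))
            ∀ (h : (tateLocalRep W 3 (Sum.inr ((Rat.HeightOneSpectrum.primesEquiv (R := 𝓞 ℚ)).symm ⟨3, Fact.out⟩))).cohomology 1),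
              expStarOmegaHom (LocalField.valuation_adicCompletion_natCast_lt_one (w₀ k r).1 3 (three_mem_asIdeal_extension _ (w₀ k r))) ((galRestrictPlace ((Rat.HeightOneSpectrum.primesEquiv (R := 𝓞 ℚ)).symm ⟨3, Fact.out⟩)).comp (absGaloisRestrict (((Rat.HeightOneSpectrum.primesEquiv (R := 𝓞 ℚ)).symm ⟨3, Fact.out⟩).adicCompletion ℚ) ((w₀ k r).1.adicCompletion (CyclotomicField (cycLevel 3 k r) ℚ)))) (dw k r) (hinjw k r) (hexw k r)
                (ContinuousRep.cohomologyRes (tateLocalRep W 3 (Sum.inr ((Rat.HeightOneSpectrum.primesEquiv (R := 𝓞 ℚ)).symm ⟨3, Fact.out⟩)))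
                  (absGaloisRestrict (((Rat.HeightOneSpectrum.primesEquiv (R := 𝓞 ℚ)).symm ⟨3, Fact.out⟩).adicCompletion ℚ) ((w₀ k r).1.adicCompletion (CyclotomicField (cycLevel 3 k r) ℚ))) 1 h) =
              algebraMap (((Rat.HeightOneSpectrum.primesEquiv (R := 𝓞 ℚ)).symm ⟨3, Fact.out⟩).adicCompletion ℚ) ((w₀ k r).1.adicCompletion (CyclotomicField (cycLevel 3 k r) ℚ)) (expStarOmegaAt dK h)) ∧
          ∀ (c d a : ℤ) (A : ℕ), 0 < A → Int.gcd c (6 * 3 * A) = 1 → Int.gcd d (6 * 3 * N) = 1 →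
            ∃ (z : ∀ (k' : ℕ) (r : (cyclotomicLevelsRat 3 (badPlaces c d A N)).Ideals),
                  H1 (tateRep W 3) ((cyclotomicLevelsRat 3 (badPlaces c d A N)).level k' r.1))
              (x : ∀ (k' : ℕ) (r : (cyclotomicLevelsRat 3 (badPlaces c d A N)).Ideals),
                  CyclotomicField (cycLevel 3 k' r.1) ℚ),
              -- (C1) Euler system [Kato 2004 (8.1.3), Prop. 8.12, Ex. 13.3]
              IsEulerSystem (cyclotomicLevelsRat 3 (badPlaces c d A N)) (tateRep W 3) 3 z ∧
              -- (C2) unramified away from 3 [Kato 2004 (8.1.3), §8.2, Lemma 8.5]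
              (∀ (k : ℕ) (r : (cyclotomicLevelsRat 3 (badPlaces c d A N)).Ideals) (v : HeightOneSpectrum (𝓞 ℚ)), ((Rat.HeightOneSpectrum.primesEquiv v : Nat.Primes) : ℕ) ≠ 3 →
                  ∀ 𝔓 ∈ v.primesAbove,
                    resLe (tateRep W 3).toTopRep
                        (inf_le_left : (cyclotomicLevelsRat 3 (badPlaces c d A N)).level k r.1 ⊓ 𝔓.inertia (absoluteGaloisGroup ℚ) ≤ (cyclotomicLevelsRat 3 (badPlaces c d A N)).level k r.1)
                        1 (z k r) = 0) ∧
              -- (C4) Kato's Thm. 9.7 for the DEFINED value datum `katoLambda` (single completion, twist family)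
              (∀ (k : ℕ) (r : (cyclotomicLevelsRat 3 (badPlaces c d A N)).Ideals),
                katoLambda W 3 k r.1 (w₀ k r.1) (Ψ k r.1) (hΨ k r.1) (three_mem_asIdeal_extension _ (w₀ k r.1))
                  (g k r.1) (hg k r.1) (dw k r.1) (hinjw k r.1) (hexw k r.1) (z k r) = (1 : ℚ_[3]) ⊗ₜ[ℚ] x k r) ∧
              -- (C5) the value law [Kato 2004 Thm. 9.7 ∘ Thm. 6.6 (1)]
              (∀ (k : ℕ) (r : (cyclotomicLevelsRat 3 (badPlaces c d A N)).Ideals) (d' : ℤ) (χ : DirichletCharacter ℂ (cycLevel 3 k r.1)) (Lχ : ℂ → ℂ),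
                  Int.gcd (c * d) (cycLevel 3 k r.1 * A) = 1 →
                  d * d' ≡ 1 [ZMOD (A : ℤ)] →
                  IsDepletedTwistedL P.f (cycLevel 3 k r.1) (3 * A) χ Lχ →
                    (χ (-1) = 1 →
                      charSum (cycLevel 3 k r.1) (ι (cycLevel 3 k r.1)) χ (x k r) =
                        (κK : ℂ) * (Lχ 1 / (plusPeriod P.f : ℂ)) *
                          cuspFactor P.f true (fun n ↦ χ⁻¹ (n : ZMod (cycLevel 3 k r.1))) c d a A d') ∧
                    (χ (-1) = -1 →
                      charSum (cycLevel 3 k r.1) (ι (cycLevel 3 k r.1)) χ (x k r) =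
                        -(κK : ℂ) * (Lχ 1 / (Complex.I * (minusPeriod P.f : ℂ))) *
                          cuspFactor P.f false (fun n ↦ χ⁻¹ (n : ZMod (cycLevel 3 k r.1))) c d a A d'))) :
    Summit.BirchSwinnertonDyer.BirchSwinnertonDyer.Theses.KimAtThreeKolyvagin.KatoKuriharaPortThreeShared :=
  KimAtThreeFineKatoPrintPositionCrux.katoKuriharaPortThreeShared_of_facts_of_katoPrintPos hA hTow hP hDR
    (exists_smul_range_expStarCoord_iff_trace_log_of_tower hTow) hKatoPrintPos₀

end Summit.BirchSwinnertonDyer.BirchSwinnertonDyer.Theorems.KimAtThreeFineKatoPrintPositionCruxFour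

end
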